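import Mathlib
import Literature.Analysis.ODE.RegularSingularAnalyticBranch

/-!
# Iterated derivatives of power series with geometrically bounded coefficients, uniformly in the coefficients
# (crux `DenseExcursion`, line `sonic-cavity-renewal`, brick for stub `stub_cavityResolventCk`, theorem T2)

Helper file (`--supports stmt-AtomisticToContinuum-12586`, line lead a2, stub-worker W4 for `stub_cavityResolventCk`).
The Frobenius series of the analytic branch at the sonic point (`Literature.Analysis.ODE.frobeniusSol`) are vector power
series `x ↦ Σ xⁿ • wₙ` with `‖wₙ‖ ≤ B λⁿ`, where `(B, λ)` are UNIFORM in the spectral parameter `Λ` on compact sets while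
the `wₙ` are not. This file provides what the `C^k → C⁰` estimate of the smooth branch needs from such series, with
constants depending on `(λ, L)` only: the `l`-th derivative is the power series with coefficients
`(n+l)!/n! • w_{n+l}`, again geometrically bounded (`norm_descFactorial_smul_le`, ratio `2^l λ`), hence for a REAL
variable `|x| < 1/(2^{L+1} λ)` every `‖(d/dx)ʲ Σ xⁿ • wₙ‖ ≤ C(λ, L)·B`, `j ≤ L` (registered helper
`powerSeries_iteratedDeriv_bound`); also the shift `Σ xⁿ • wₙ = w₀ + x • Σ xⁿ • w_{n+1}` and the identification of
iterated derivatives of a chain of derivatives (`iteratedDeriv_eq_of_deriv_family`). Sources: folklore (Weierstrass).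
-/

noncomputable section

open Set Filter
open scoped Topology ContDiff

namespace Summit.AtomisticToContinuum.HydrodynamicLimit.Theorems.SonicCavityRenewal

open Literature.Analysis.ODE (summable_norm_pow_smul hasDerivAt_tsum_pow_smul norm_tsum_pow_smul_le)

section RealVariable

variable {E : Type*} [NormedAddCommGroup E] [NormedSpace ℝ E]

/-- For a chain of derivatives `F₀, F₁, …, F_L` on an open set, the iterated derivatives of `F₀` are the `Fⱼ`. [folklore] -/
theorem iteratedDeriv_eq_of_deriv_family {s : Set ℝ} (hs : IsOpen s) (F : ℕ → ℝ → E) (L : ℕ)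
    (hF : ∀ j < L, ∀ x ∈ s, HasDerivAt (F j) (F (j + 1) x) x) :
    ∀ j ≤ L, EqOn (iteratedDeriv j (F 0)) (F j) s := by
  intro j
  induction j with
  | zero => intro _ x _; simp
  | succ j ih =>
    intro hj x hx
    have h1 : iteratedDeriv j (F 0) =ᶠ[𝓝 x] F j :=
      Filter.eventuallyEq_of_mem (hs.mem_nhds hx) (ih (Nat.le_of_succ_le hj))
    rw [iteratedDeriv_succ, h1.deriv_eq]
    exact (hF j (Nat.lt_of_succ_le hj) x hx).deriv

end RealVariable

section Series

variable {F : Type*} [NormedAddCommGroup F] [NormedSpace ℂ F]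

/-- Restriction to the real line of a complex derivative (vector values). [folklore] -/
theorem hasDerivAt_comp_ofReal [NormedSpace ℝ F] [IsScalarTower ℝ ℂ F] {e : ℂ → F} {e' : F} {z : ℝ}
    (hf : HasDerivAt e e' (z : ℂ)) : HasDerivAt (fun y : ℝ => e (y : ℂ)) e' z := by
  have h := (hf.hasFDerivAt.restrictScalars ℝ).comp_hasDerivAt z Complex.ofRealCLM.hasDerivAt
  simpa [Function.comp_def] using h

/-- The derived coefficients `(n+1) • w_{n+1}` of a geometrically bounded sequence are geometrically bounded with the
doubled ratio: `‖(n+1) • w_{n+1}‖ ≤ (Bλ)(2λ)ⁿ`. [folklore] -/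
theorem norm_succ_smul_le {w : ℕ → F} {B lam : ℝ} (hw : ∀ n, ‖w n‖ ≤ B * lam ^ n) (n : ℕ) :
    ‖((n + 1 : ℕ) : ℂ) • w (n + 1)‖ ≤ B * lam * (2 * lam) ^ n := by
  have hB : 0 ≤ B := by simpa using (norm_nonneg _).trans (hw 0)
  rw [norm_smul, Complex.norm_natCast]
  have h2 : ((n + 1 : ℕ) : ℝ) ≤ 2 ^ n := by exact_mod_cast Nat.succ_le_of_lt n.lt_two_pow_self
  calc ((n + 1 : ℕ) : ℝ) * ‖w (n + 1)‖ ≤ 2 ^ n * (B * lam ^ (n + 1)) :=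
        mul_le_mul h2 (hw _) (norm_nonneg _) (by positivity)
    _ = B * lam * (2 * lam) ^ n := by rw [mul_pow, pow_succ]; ring

/-- The coefficients `(n+l)!/n! • w_{n+l}` of the `l`-th derived series are geometrically bounded with ratio `2^l λ` and a
constant `C(λ, l)·B` LINEAR in `B`. [folklore] -/
theorem norm_descFactorial_smul_le (lam : ℝ) (hlam : 0 ≤ lam) (l : ℕ) : ∃ C : ℝ, 0 ≤ C ∧ ∀ (w : ℕ → F) (B : ℝ),
    (∀ n, ‖w n‖ ≤ B * lam ^ n) → ∀ n, ‖(((n + l).descFactorial l : ℕ) : ℂ) • w (n + l)‖ ≤ C * B * (2 ^ l * lam) ^ n := by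
  induction l with
  | zero => exact ⟨1, zero_le_one, fun w B hw n => by simpa using hw n⟩
  | succ l ih =>
    obtain ⟨C, hC0, hC⟩ := ih
    refine ⟨C * (2 ^ l * lam), by positivity, fun w B hw n => ?_⟩
    have key := norm_succ_smul_le (w := fun n => (((n + l).descFactorial l : ℕ) : ℂ) • w (n + l)) (hC w B hw) n
    have e : (n + 1) * (n + 1 + l).descFactorial l = (n + (l + 1)).descFactorial (l + 1) := by
      rw [Nat.descFactorial_succ, show n + (l + 1) - l = n + 1 by omega, show n + (l + 1) = n + 1 + l by omega]
    rw [← e, Nat.cast_mul, mul_smul, show n + (l + 1) = n + 1 + l by omega]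
    calc _ ≤ C * B * (2 ^ l * lam) * (2 * (2 ^ l * lam)) ^ n := key
      _ = C * (2 ^ l * lam) * B * (2 ^ (l + 1) * lam) ^ n := by rw [pow_succ]; ring

variable [CompleteSpace F]

/-- TERM-WISE DIFFERENTIATION in shifted form: inside `λ‖x‖ < 1` the derivative of `Σ xⁿ • wₙ` is the power series
`Σ xⁿ • ((n+1) • w_{n+1})`. [folklore] -/
theorem hasDerivAt_tsum_pow_smul_shift {w : ℕ → F} {B lam : ℝ} (hw : ∀ n, ‖w n‖ ≤ B * lam ^ n) (hlam : 0 ≤ lam)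
    {x : ℂ} (hx : lam * ‖x‖ < 1) :
    HasDerivAt (fun y : ℂ => ∑' n, y ^ n • w n) (∑' n, x ^ n • (((n + 1 : ℕ) : ℂ) • w (n + 1))) x := by
  obtain ⟨hsum, hder⟩ := hasDerivAt_tsum_pow_smul hw hlam hx
  convert hder using 1
  rw [hsum.tsum_eq_zero_add]
  simp only [Nat.cast_zero, zero_mul, zero_smul, zero_add, Nat.add_sub_cancel]
  exact tsum_congr fun n => by rw [smul_smul, mul_comm]

/-- THE CHAIN OF DERIVED SERIES: inside `2^l λ ‖x‖ < 1`, the `l`-th derived series differentiates to the `(l+1)`-st.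
[folklore] -/
theorem hasDerivAt_tsum_pow_smul_family {w : ℕ → F} {B lam : ℝ} (hw : ∀ n, ‖w n‖ ≤ B * lam ^ n) (hlam : 0 ≤ lam)
    (l : ℕ) {x : ℂ} (hx : 2 ^ l * lam * ‖x‖ < 1) :
    HasDerivAt (fun y : ℂ => ∑' n, y ^ n • ((((n + l).descFactorial l : ℕ) : ℂ) • w (n + l)))
      (∑' n, x ^ n • ((((n + (l + 1)).descFactorial (l + 1) : ℕ) : ℂ) • w (n + (l + 1)))) x := by
  obtain ⟨C, -, hC⟩ := norm_descFactorial_smul_le (F := F) lam hlam l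
  refine (hasDerivAt_tsum_pow_smul_shift (hC w B hw) (by positivity) hx).congr_deriv (tsum_congr fun n => ?_)
  have e : (n + 1) * (n + (l + 1)).descFactorial l = (n + (l + 1)).descFactorial (l + 1) := by
    rw [Nat.descFactorial_succ, show n + (l + 1) - l = n + 1 by omega]
  congr 1
  rw [smul_smul, ← Nat.cast_mul, show n + 1 + l = n + (l + 1) by omega, e]

/-- THE SHIFT: inside `λ‖x‖ < 1`, `Σ xⁿ • wₙ = w₀ + x • Σ xⁿ • w_{n+1}`, and the shifted sequence is bounded by
`(Bλ)λⁿ`. [folklore] -/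
theorem tsum_pow_smul_shift {w : ℕ → F} {B lam : ℝ} (hw : ∀ n, ‖w n‖ ≤ B * lam ^ n) (hlam : 0 ≤ lam) {x : ℂ}
    (hx : lam * ‖x‖ < 1) :
    (∑' n, x ^ n • w n) = w 0 + x • ∑' n, x ^ n • w (n + 1) ∧ ∀ n, ‖w (n + 1)‖ ≤ B * lam * lam ^ n := by
  have hw' : ∀ n, ‖w (n + 1)‖ ≤ B * lam * lam ^ n := fun n => by rw [mul_assoc, ← pow_succ']; exact hw (n + 1)
  refine ⟨?_, hw'⟩
  rw [(summable_norm_pow_smul hw hlam hx).of_norm.tsum_eq_zero_add]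
  simp only [pow_zero, one_smul, pow_succ', mul_smul]
  rw [(summable_norm_pow_smul hw' hlam hx).of_norm.tsum_const_smul]

/-- REAL VARIABLE, SUP BOUNDS: on `|x| < 1/(2^{L+1} λ)` the derived series of order `l ≤ L` is bounded by `2 C(λ,l) B`.
[folklore] -/
theorem norm_tsum_pow_smul_family_le (lam : ℝ) (hlam : 0 < lam) (l : ℕ) : ∃ C : ℝ, 0 ≤ C ∧ ∀ (w : ℕ → F) (B : ℝ),
    (∀ n, ‖w n‖ ≤ B * lam ^ n) → ∀ L, l ≤ L → ∀ x : ℝ, |x| < 1 / (2 ^ (L + 1) * lam) →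
      ‖∑' n, (x : ℂ) ^ n • ((((n + l).descFactorial l : ℕ) : ℂ) • w (n + l))‖ ≤ 2 * C * B := by
  obtain ⟨C, hC0, hC⟩ := norm_descFactorial_smul_le (F := F) lam hlam.le l
  refine ⟨C, hC0, fun w B hw L hl x hx => ?_⟩
  have hB : 0 ≤ B := by simpa using (norm_nonneg _).trans (hw 0)
  have hx' : 2 ^ l * lam * ‖(x : ℂ)‖ ≤ 1 / 2 := by
    rw [Complex.norm_real, Real.norm_eq_abs]
    rw [lt_div_iff₀ (by positivity)] at hx
    have h2 : (2 : ℝ) ^ l ≤ 2 ^ L := pow_le_pow_right₀ (by norm_num) hl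
    calc 2 ^ l * lam * |x| ≤ 2 ^ L * lam * |x| := by gcongr
      _ = (|x| * (2 ^ (L + 1) * lam)) / 2 := by rw [pow_succ]; ring
      _ ≤ 1 / 2 := by linarith
  calc _ ≤ C * B / (1 - 2 ^ l * lam * ‖(x : ℂ)‖) := norm_tsum_pow_smul_le (hC w B hw) (by positivity) (by linarith)
    _ ≤ C * B / (1 / 2) := div_le_div_of_nonneg_left (by positivity) (by norm_num) (by linarith)
    _ = 2 * C * B := by ring

variable [NormedSpace ℝ F] [IsScalarTower ℝ ℂ F]

/-- REAL VARIABLE: on `|x| < 1/(2^L λ)` the iterated derivatives of order `l ≤ L` of `x ↦ Σ xⁿ • wₙ` are the derived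
series. [folklore] -/
theorem iteratedDeriv_tsum_pow_smul {w : ℕ → F} {B lam : ℝ} (hw : ∀ n, ‖w n‖ ≤ B * lam ^ n) (hlam : 0 < lam)
    (L : ℕ) : ∀ l ≤ L, ∀ x : ℝ, |x| < 1 / (2 ^ L * lam) →
      iteratedDeriv l (fun y : ℝ => ∑' n, (y : ℂ) ^ n • w n) x =
        ∑' n, (x : ℂ) ^ n • ((((n + l).descFactorial l : ℕ) : ℂ) • w (n + l)) := by
  intro l hl x hx
  have hopen : IsOpen {x : ℝ | |x| < 1 / (2 ^ L * lam)} := isOpen_lt continuous_abs continuous_const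
  have key := iteratedDeriv_eq_of_deriv_family hopen
    (fun j (y : ℝ) => ∑' n, (y : ℂ) ^ n • ((((n + j).descFactorial j : ℕ) : ℂ) • w (n + j))) L ?_ l hl hx
  · simpa using key
  · intro j hj y hy
    refine hasDerivAt_comp_ofReal (hasDerivAt_tsum_pow_smul_family hw hlam.le j ?_)
    have hy' : |y| < 1 / (2 ^ L * lam) := hy
    rw [Complex.norm_real, Real.norm_eq_abs]
    rw [lt_div_iff₀ (by positivity)] at hy'
    calc 2 ^ j * lam * |y| ≤ 2 ^ L * lam * |y| := by gcongr; norm_num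
      _ = |y| * (2 ^ L * lam) := by ring
      _ < 1 := hy'

end Series

/-- **Registered helper `powerSeries_iteratedDeriv_bound`: UNIFORM `C^L` BOUNDS FOR VECTOR POWER SERIES.** For a ratio
`λ > 0` and an order `L` there is `C = C(λ, L)` such that every `ℂ²`-valued power series `x ↦ Σ xⁿ • wₙ` of a real
variable with `‖wₙ‖ ≤ B λⁿ` has all `x`-derivatives of order `j ≤ L` bounded by `C·B` on `|x| < 1/(2^{L+1} λ)` — the
form in which the Frobenius majorant (uniform in the spectral parameter) controls the smooth branch in `C^k`. [folklore] -/
theorem powerSeries_iteratedDeriv_bound : ∀ (lam : ℝ) (L : ℕ), 0 < lam → ∃ C : ℝ, 0 ≤ C ∧ ∀ (w : ℕ → ℂ × ℂ) (B : ℝ), (∀ n, ‖w n‖ ≤ B * lam ^ n) → ∀ j : ℕ, j ≤ L → ∀ x : ℝ, |x| < 1 / (2 ^ (L + 1) * lam) → ‖iteratedDeriv j (fun y : ℝ => ∑' n, (y : ℂ) ^ n • w n) x‖ ≤ C * B := by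
  intro lam L hlam
  choose C hC0 hC using fun l => norm_tsum_pow_smul_family_le (F := ℂ × ℂ) lam hlam l
  refine ⟨2 * ∑ l ∈ Finset.range (L + 1), C l, mul_nonneg zero_le_two (Finset.sum_nonneg fun l _ => hC0 l),
    fun w B hw j hj x hx => ?_⟩
  have hB : 0 ≤ B := by simpa using (norm_nonneg _).trans (hw 0)
  have hx' : |x| < 1 / (2 ^ L * lam) := by
    refine hx.trans_le (div_le_div_of_nonneg_left zero_le_one (by positivity : (0 : ℝ) < 2 ^ L * lam) ?_)
    rw [pow_succ]; nlinarith [pow_pos (two_pos : (0 : ℝ) < 2) L]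
  rw [iteratedDeriv_tsum_pow_smul hw hlam L j hj x hx']
  calc _ ≤ 2 * C j * B := hC j w B hw L hj x hx
    _ ≤ 2 * (∑ l ∈ Finset.range (L + 1), C l) * B := by
        gcongr
        exact Finset.single_le_sum (fun l _ => hC0 l) (Finset.mem_range.2 (Nat.lt_succ_of_le hj))
    _ = _ := by ring

end Summit.AtomisticToContinuum.HydrodynamicLimit.Theorems.SonicCavityRenewal

end
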